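import Summits.CriticalPhenomena.Ising3DConformalLimit.Theses.BallOrbitComparison
import Summits.CriticalPhenomena.Ising3DConformalLimit.Theorems.HyperoctahedralRPExistsScaleCovariantLimitFoldedCurrentTwoPointLimitEta
import Summits.CriticalPhenomena.Ising3DConformalLimit.Theorems.EnergyNotSigmaSquaredMoebiusLimitExistsClusterPointOS
import Summits.CriticalPhenomena.Ising3DConformalLimit.Theorems.EnergyNotSigmaSquaredMoebiusLimitExistsClusterPointB3
import Summits.CriticalPhenomena.Ising3DConformalLimit.Theorems.HyperoctahedralRPTwoPointKernelOfLimitClauses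
import HarnessLib

/-!
# Stub `stub_clusterKernelOfRV` of line `cluster-light-cone` (crux `ClusterSetTotallyDisconnected`,
# item stmt-CriticalPhenomena-4659): under axis regular variation every cluster kernel is a pinned,
# hyperoctahedrally invariant, enveloped two-point kernel

Registered stub `stub_clusterKernelOfRV` of the checked skeleton
`Cruxes/ClusterSetTotallyDisconnected/Lines/cluster_light_cone.lean` (strategist line `cluster-light-cone`, item
stmt-CriticalPhenomena-4659 `…Theses.UnitLightCone.ClusterSetTotallyDisconnected` =
`…Theses.ClusterRigidity.ClusterSetTotallyDisconnected`), proved BY NAME with the registered signature.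

**Statement.** Assume item stmt-CriticalPhenomena-5047 `BallOrbitComparison.TwoPointRegularVariation`
(`ρ(cδ)/ρ(δ) → c^{-Δ}` as `δ → 0⁺` for every `c > 0`, `ρ(δ) = ⟨σ₀σ_{⌊1/δ⌋e₀}⟩_{β_c}^{-1/2}`, some `Δ > 0`). Then
`1/2 ≤ Δ ≤ 1`, and every member `S` of the cluster set `𝒞` of the self-normalised critical `ℤ³` correlators
(normalised locally uniform limits of `ρ(u_k)ⁿ⟨∏σ_{[xᵢ/u_k]}⟩_{β_c}` along a mesh sequence `u_k → 0⁺`) has a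
two-point kernel `K_S x = S 2 (0, x)` which is translation invariant, positive off `0`, invariant under every
linear isometry permuting the signed coordinate axes, equal to `r^{-2Δ}` at `r e₀`, and `≤ 6^{2Δ}‖x‖^{-2Δ}`.

**Proof (all inputs landed).**
* `ρ = ρ_pin` (`rv_rho_pt_clc`), so 5047 is the ratio law `ρ_pin(cδ)/ρ_pin(δ) → c^{-Δ}`.
* Window: at `c = 1/2`, Lamperti/Cesàro along `δ = 2^{-k}` (`tendsto_log_renorm_div_of_ratio_half`) gives
  `log g(2^k)/k → −2Δ log 2` for `g(m) = ⟨σ₀σ_{me₀}⟩_{β_c}`, and the envelopes `c m⁻² ≤ g ≤ C m⁻¹`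
  (`half_le_of_log_axis_dyadic`, `le_one_of_log_axis_dyadic`) give `Δ ∈ [1/2, 1]`.
* Axis profile: at `c = 1/t` the ratio law reads `g(⌊t/δ⌋)/g(⌊1/δ⌋) → t^{-2Δ}` (`rv_axis_limit_clc`); the pinned
  zoom at the pair `(0, t e₀)` IS this ratio (`pz_two_cfg0`), so along the cluster sequence `S 2 (0, t e₀) = t^{-2Δ}`.
* Translation invariance (`seqLimit_translate`), positivity (`clusterPoint_nondeg_two`), invariance under the
  coordinate permutations (`clusterPoint_coordPerm_invariant`) and the coordinate reflections
  (`IsClusterPoint.isReflectionInvariantAlong_os`, with the automatic continuity `continuousOn_of_isClusterPoint`)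
  of cluster points are landed; an axis-permuting isometry `R` is `P_π ∘ (sign changes)`
  (`exists_perm_signs_of_isHyper_clc`, `isHyper_apply_clc`), and a sign change is a composite of at most three
  coordinate reflections (`flip_step_clc`), whence `K_S ∘ R = K_S` (`kernel_hyper_clc`).
* Envelope: the inward Messager–Miracle-Solé comparison along the cluster sequence
  (`clusterPoint_two_le_of_mul_norm_lt`) at the axis pair `(0, (‖x‖/6) e₀)` (`3‖x‖/6 < ‖x‖_∞` since
  `‖x‖ < 2‖x‖_∞` on `ℝ³`) gives `K_S x ≤ (‖x‖/6)^{-2Δ} = 6^{2Δ}‖x‖^{-2Δ}`.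

No definitions, no `sorry`. References: Messager–Miracle-Solé 1977 (monotonicity, through the tree theorem
`clusterPoint_two_le_of_mul_norm_lt`); Lamperti 1962 Thm 2 (through `tendsto_log_renorm_div_of_ratio_half`);
the hyperoctahedral decomposition is adapted from `Summits/QuantumFields/YangMills/Theorems/NPointIsotropy/Negative/HyperoctahedralPlane.lean`
(`exists_sp_of_isHyper`). [folklore]
-/

noncomputable section

namespace Summit.CriticalPhenomena.Ising3DConformalLimit.Cruxes.ClusterSetTotallyDisconnected.ClusterLightCone

open Filter Set
open scoped Topology RealInnerProductSpace
open Literature.Probability.LatticeModels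
open Literature.MathematicalPhysics.QuantumFieldTheory (axisReflection axisReflection_apply)
open Summit.CriticalPhenomena.Ising3DConformalLimit.MoebiusLimitExistsOnlyInteraction
  (rhoPin IsClusterPoint IsNormalised rhoPin_pos clusterPoint_coordPerm_invariant)
open Summit.CriticalPhenomena.Ising3DConformalLimit.MoebiusLimitExistsNegative
  (clusterPoint_two_conv clusterPoint_two_le_of_mul_norm_lt norm_axisPair_sub' coordPerm_apply)
open Summit.CriticalPhenomena.Ising3DConformalLimit.ReflectionTwinExistsContinuousLimit (clusterPoint_nondeg_two)
open Summit.CriticalPhenomena.Ising3DConformalLimit.PinnedClusterPoints (criticalTwoPoint_pos3)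
open Summit.CriticalPhenomena.Ising3DConformalLimit.HyperoctahedralRPTwoPoint
  (zero_pair_mem_nonCoincident comp_zeroPair)
open Summit.CriticalPhenomena.Ising3DConformalLimit.ExistsScaleCovariantLimitNegative.Dyadic (cfg0_mem pz_two_cfg0)
open Summit.CriticalPhenomena.Ising3DConformalLimit.Cruxes.ExistsScaleCovariantLimit.TwoHierarchies
  (continuousOn_of_isClusterPoint seqLimit_translate)
open Summit.CriticalPhenomena.Ising3DConformalLimit.Cruxes.ExistsScaleCovariantLimit.FoldedCurrentRepulsion
  (isClusterPoint_of_mem_clusterSet half_le_of_log_axis_dyadic le_one_of_log_axis_dyadic)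

/-! ## §1 Item 5047 in terms of the pinned renormalisation `ρ_pin` -/

/-- The renormalisation of item 5047 is the pinned one: `1/√⟨σ₀σ_{⌊δ⁻¹⌋e₀}⟩ = ρ_pin(δ)`. [folklore] -/
theorem rv_rho_pt_clc (δ : ℝ) :
    1 / Real.sqrt (criticalTwoPoint 3 (Pi.single 0 ⌊δ⁻¹⌋)) = rhoPin δ := by
  unfold MoebiusLimitExistsOnlyInteraction.rhoPin
  rw [one_div δ, Real.sqrt_eq_rpow, one_div, ← Real.rpow_neg (criticalTwoPoint_nonneg' _)]

/-- Item 5047 read through `ρ_pin`: `∃ Δ > 0, ∀ c > 0, ρ_pin(cδ)/ρ_pin(δ) → c^{-Δ}` as `δ → 0⁺`. [folklore] -/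
theorem rv_ratio_rhoPin_clc
    (hRV : Summit.CriticalPhenomena.Ising3DConformalLimit.Theses.BallOrbitComparison.TwoPointRegularVariation) :
    ∃ Δ : ℝ, 0 < Δ ∧ ∀ c : ℝ, 0 < c →
      Tendsto (fun δ => rhoPin (c * δ) / rhoPin δ) (𝓝[>] (0:ℝ)) (𝓝 (c ^ (-Δ))) := by
  obtain ⟨Δ, hΔ, hT⟩ := hRV
  refine ⟨Δ, hΔ, fun c hc => ?_⟩
  have h : Tendsto (fun δ : ℝ => (1 / Real.sqrt (criticalTwoPoint 3 (Pi.single 0 ⌊(c * δ)⁻¹⌋))) /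
      (1 / Real.sqrt (criticalTwoPoint 3 (Pi.single 0 ⌊δ⁻¹⌋)))) (𝓝[>] (0:ℝ)) (𝓝 (c ^ (-Δ))) := hT c hc
  simpa only [rv_rho_pt_clc] using h

/-! ## §2 The window `Δ ∈ [1/2, 1]` -/

/-- **The window.** If `ρ_pin(cδ)/ρ_pin(δ) → c^{-Δ}` for every `c > 0` then `1/2 ≤ Δ ≤ 1`: at `c = 1/2`,
Lamperti/Cesàro along `δ = 2^{-k}` gives `log g(2^k)/k → −2Δ log 2`, and the envelopes `c m⁻² ≤ g(m) ≤ C m⁻¹`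
pin the slope. [cite: Lamperti1962, Theorem 2] -/
theorem rv_window_clc {Δ : ℝ}
    (hT : ∀ c : ℝ, 0 < c → Tendsto (fun δ => rhoPin (c * δ) / rhoPin δ) (𝓝[>] (0:ℝ)) (𝓝 (c ^ (-Δ)))) :
    1/2 ≤ Δ ∧ Δ ≤ 1 := by
  -- adapted from Theorems/HyperoctahedralRPExistsScaleCovariantLimitFoldedCurrentTwoPointLimitEta.lean
  have hratio : Tendsto (fun δ => rhoPin (1/2 * δ) / rhoPin δ) (𝓝[>] 0) (𝓝 ((1/2:ℝ) ^ (-Δ))) :=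
    hT (1/2) (by norm_num)
  have hlog := tendsto_log_renorm_div_of_ratio_half rhoPin_pos hratio
  have hdy : Tendsto (fun k : ℕ => Real.log (criticalTwoPoint 3 (Pi.single 0 ((2 ^ k : ℕ) : ℤ))) / k) atTop
      (𝓝 (-(2 * Δ) * Real.log 2)) := by
    have h2 := hlog.const_mul (-2)
    have hval : (-2:ℝ) * (Δ * Real.log 2) = -(2 * Δ) * Real.log 2 := by ring
    rw [hval] at h2
    refine h2.congr fun k => ?_
    have hfl : ⌊(1:ℝ) / ((1/2:ℝ) ^ k)⌋ = ((2 ^ k : ℕ) : ℤ) := by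
      rw [one_div, one_div, inv_pow, inv_inv, show ((2:ℝ) ^ k) = (((2 ^ k : ℕ) : ℤ) : ℝ) by push_cast; rfl,
        Int.floor_intCast]
    have hg : 0 < criticalTwoPoint 3 (Pi.single 0 ((2 ^ k : ℕ) : ℤ)) := criticalTwoPoint_pos3 _
    show -2 * (Real.log (rhoPin ((1/2:ℝ) ^ k)) / k) =
      Real.log (criticalTwoPoint 3 (Pi.single 0 ((2 ^ k : ℕ) : ℤ))) / k
    unfold MoebiusLimitExistsOnlyInteraction.rhoPin
    rw [hfl, Real.log_rpow hg]
    ring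
  exact ⟨half_le_of_log_axis_dyadic hdy, le_one_of_log_axis_dyadic hdy⟩

/-! ## §3 The pinned axis profile -/

/-- **The ratio law at `c = 1/t`**: `g(⌊t/δ⌋)/g(⌊1/δ⌋) → t^{-2Δ}` as `δ → 0⁺` (`g(m) = ⟨σ₀σ_{me₀}⟩_{β_c}`), i.e.
`(ρ_pin(δ/t)/ρ_pin(δ))^{-2} → (t^{Δ})^{-2}`. [folklore] -/
theorem rv_axis_limit_clc {Δ : ℝ}
    (hT : ∀ c : ℝ, 0 < c → Tendsto (fun δ => rhoPin (c * δ) / rhoPin δ) (𝓝[>] (0:ℝ)) (𝓝 (c ^ (-Δ))))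
    {t : ℝ} (ht : 0 < t) :
    Tendsto (fun δ : ℝ => criticalTwoPoint 3 (Pi.single 0 ⌊t / δ⌋) / criticalTwoPoint 3 (Pi.single 0 ⌊1 / δ⌋))
      (𝓝[>] (0:ℝ)) (𝓝 (t ^ (-(2 * Δ)))) := by
  have hti : 0 < t⁻¹ := inv_pos.2 ht
  have hne : (t⁻¹ ^ (-Δ)) ≠ 0 := (Real.rpow_pos_of_pos hti _).ne'
  have h := (hT t⁻¹ hti).rpow_const (p := (-2:ℝ)) (Or.inl hne)
  have hval : (t⁻¹ ^ (-Δ)) ^ (-2:ℝ) = t ^ (-(2 * Δ)) := by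
    rw [← Real.rpow_mul hti.le, Real.inv_rpow ht.le, ← Real.rpow_neg ht.le]
    congr 1
    ring
  rw [hval] at h
  refine h.congr' ?_
  filter_upwards [self_mem_nhdsWithin] with δ hδ
  rw [Set.mem_Ioi] at hδ
  have e1 : (1:ℝ) / (t⁻¹ * δ) = t / δ := by
    field_simp
  have hA := criticalTwoPoint_pos3 (Pi.single 0 ⌊1 / δ⌋)
  have hB := criticalTwoPoint_pos3 (Pi.single 0 ⌊t / δ⌋)
  show (rhoPin (t⁻¹ * δ) / rhoPin δ) ^ (-2:ℝ) = _
  unfold MoebiusLimitExistsOnlyInteraction.rhoPin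
  rw [e1, ← Real.div_rpow hB.le hA.le, ← Real.rpow_mul (div_pos hB hA).le]
  norm_num

/-- **The pinned axis profile of a cluster point**: under the ratio law, `S 2 (0, t e₀) = t^{-2Δ}` for every
cluster point `S` of the pinned zoom and every `t > 0` (the zoom at `(0, t e₀)` is EXACTLY `g(⌊t/u_k⌋)/g(⌊1/u_k⌋)`).
[folklore] -/
theorem clusterPoint_axis_profile_clc {Δ : ℝ}
    (hT : ∀ c : ℝ, 0 < c → Tendsto (fun δ => rhoPin (c * δ) / rhoPin δ) (𝓝[>] (0:ℝ)) (𝓝 (c ^ (-Δ))))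
    {S : CorrFamily 3} (hS : IsClusterPoint S) {t : ℝ} (ht : 0 < t) :
    S 2 (![0, EuclideanSpace.single 0 t] : Fin 2 → EuclideanSpace ℝ (Fin 3)) = t ^ (-(2 * Δ)) := by
  obtain ⟨u, hu, hconv⟩ := hS
  have h1 := (hconv 2).tendsto_at (cfg0_mem ht.ne')
  have h2 : Tendsto (fun k => rescaledCorrelator (criticalCorr 3) rhoPin 2 (u k)
      (![0, EuclideanSpace.single 0 t] : Fin 2 → EuclideanSpace ℝ (Fin 3))) atTop (𝓝 (t ^ (-(2 * Δ)))) := by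
    refine ((rv_axis_limit_clc hT ht).comp hu).congr fun k => ?_
    simp only [Function.comp_apply]
    rw [pz_two_cfg0]
  exact tendsto_nhds_unique h1 h2

/-- `r • e₀ = single 0 r`. [folklore] -/
theorem smul_single_one_clc (r : ℝ) :
    r • EuclideanSpace.single (0 : Fin 3) (1:ℝ) = EuclideanSpace.single 0 r := by
  ext j
  by_cases hj : j = 0
  · subst hj; simp
  · simp [hj]

/-! ## §4 The landed symmetries of cluster points, read on the kernel `x ↦ S 2 (0, x)` -/

/-- The kernel of a normalised cluster point is invariant under the coordinate permutations of `ℝ³`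
(landed `clusterPoint_coordPerm_invariant`). [folklore] -/
theorem kernel_coordPerm_clc {S : CorrFamily 3} (hS : IsClusterPoint S) (hN : IsNormalised S)
    (π : Equiv.Perm (Fin 3)) (y : EuclideanSpace ℝ (Fin 3)) :
    S 2 (![0, LinearIsometryEquiv.piLpCongrLeft 2 ℝ ℝ π y] : Fin 2 → EuclideanSpace ℝ (Fin 3)) =
      S 2 (![0, y] : Fin 2 → EuclideanSpace ℝ (Fin 3)) := by
  have h := clusterPoint_coordPerm_invariant S hS hN π 2 (![0, y] : Fin 2 → EuclideanSpace ℝ (Fin 3))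
  rwa [comp_zeroPair (map_zero _)] at h

/-- The kernel of a normalised cluster point is invariant under the coordinate reflections `θ_τ` (landed
`IsClusterPoint.isReflectionInvariantAlong_os` with the automatic continuity `continuousOn_of_isClusterPoint`).
[folklore] -/
theorem kernel_axisReflection_clc {S : CorrFamily 3} (hS : IsClusterPoint S) (hN : IsNormalised S)
    (τ : Fin 3) (y : EuclideanSpace ℝ (Fin 3)) :
    S 2 (![0, axisReflection τ y] : Fin 2 → EuclideanSpace ℝ (Fin 3)) =
      S 2 (![0, y] : Fin 2 → EuclideanSpace ℝ (Fin 3)) := by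
  have h := (hS.isReflectionInvariantAlong_os hN (continuousOn_of_isClusterPoint hS) τ) 2
    (![0, y] : Fin 2 → EuclideanSpace ℝ (Fin 3))
  rwa [comp_zeroPair (map_zero _)] at h

/-! ## §5 Axis-permuting isometries are generated by coordinate permutations and reflections -/

/-- An isometry of `ℝ³` permuting the signed coordinate axes is `eᵢ ↦ εᵢ e_{π i}` for a permutation `π` and
signs `εᵢ = ±1` (injectivity of `i ↦ j(i)` from orthogonality). [folklore] -/
theorem exists_perm_signs_of_isHyper_clc (R : EuclideanSpace ℝ (Fin 3) ≃ₗᵢ[ℝ] EuclideanSpace ℝ (Fin 3))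
    (hR : ∀ i : Fin 3, ∃ j : Fin 3, R (EuclideanSpace.single i 1) = EuclideanSpace.single j 1 ∨
      R (EuclideanSpace.single i 1) = -EuclideanSpace.single j 1) :
    ∃ (π : Equiv.Perm (Fin 3)) (ε : Fin 3 → ℝ), (∀ i, ε i = 1 ∨ ε i = -1) ∧
      ∀ i, R (EuclideanSpace.single i 1) = ε i • EuclideanSpace.single (π i) 1 := by
  -- adapted from Summits/QuantumFields/YangMills/Theorems/NPointIsotropy/Negative/HyperoctahedralPlane.lean (`exists_sp_of_isHyper`)
  classical
  choose j hj using hR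
  have hj' : ∀ i, ∃ e : ℝ, (e = 1 ∨ e = -1) ∧
      R (EuclideanSpace.single i 1) = e • EuclideanSpace.single (j i) 1 := by
    intro i
    rcases hj i with h | h
    · exact ⟨1, Or.inl rfl, by rw [h, one_smul]⟩
    · exact ⟨-1, Or.inr rfl, by rw [h, neg_one_smul]⟩
  choose ε hε hb using hj'
  have hε0 : ∀ i, ε i ≠ 0 := fun i => by rcases hε i with h | h <;> rw [h] <;> norm_num
  have hinj : Function.Injective j := by
    intro i i' hii'
    by_contra hne
    have h0 : ⟪EuclideanSpace.single i (1 : ℝ), EuclideanSpace.single i' 1⟫ = 0 := by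
      rw [EuclideanSpace.inner_single_left]
      simp [hne]
    rw [← R.inner_map_map, hb i, hb i', real_inner_smul_left, real_inner_smul_right, hii',
      EuclideanSpace.inner_single_left] at h0
    simp [hε0] at h0
  exact ⟨Equiv.ofBijective j (Finite.injective_iff_bijective.1 hinj), ε, hε, fun i => hb i⟩

/-- Coordinates of an axis-permuting isometry: `(R x)_k = ε_{π⁻¹k} x_{π⁻¹k}`. [folklore] -/
theorem isHyper_apply_clc {R : EuclideanSpace ℝ (Fin 3) ≃ₗᵢ[ℝ] EuclideanSpace ℝ (Fin 3)}
    {π : Equiv.Perm (Fin 3)} {ε : Fin 3 → ℝ} (hε : ∀ i, ε i = 1 ∨ ε i = -1)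
    (hb : ∀ i, R (EuclideanSpace.single i 1) = ε i • EuclideanSpace.single (π i) 1)
    (x : EuclideanSpace ℝ (Fin 3)) (k : Fin 3) :
    R x k = ε (π.symm k) * x (π.symm k) := by
  have hεsq : ε (π.symm k) * ε (π.symm k) = 1 := by
    rcases hε (π.symm k) with h | h <;> rw [h] <;> norm_num
  have hsymm : R.symm (EuclideanSpace.single k 1) = ε (π.symm k) • EuclideanSpace.single (π.symm k) 1 := by
    apply R.injective
    rw [LinearIsometryEquiv.apply_symm_apply, map_smul, hb (π.symm k), Equiv.apply_symm_apply, smul_smul,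
      hεsq, one_smul]
  have h1 : R x k = ⟪EuclideanSpace.single k (1:ℝ), R x⟫ := by
    rw [EuclideanSpace.inner_single_left]
    simp
  rw [h1, ← LinearIsometryEquiv.apply_symm_apply R (EuclideanSpace.single k 1), R.inner_map_map, hsymm,
    real_inner_smul_left, EuclideanSpace.inner_single_left]
  simp

/-- One sign change `x_τ ↦ e x_τ`, `e = ±1`, is the identity or the reflection `θ_τ`; a `θ`-invariant function
does not see it. [folklore] -/
theorem flip_step_clc {T : EuclideanSpace ℝ (Fin 3) → ℝ}
    (hF : ∀ (τ : Fin 3) (y : EuclideanSpace ℝ (Fin 3)), T (axisReflection τ y) = T y)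
    (τ : Fin 3) (e : ℝ) (he : e = 1 ∨ e = -1) (y : EuclideanSpace ℝ (Fin 3)) :
    ∃ y' : EuclideanSpace ℝ (Fin 3), T y' = T y ∧ ∀ j, y' j = if j = τ then e * y j else y j := by
  rcases he with rfl | rfl
  · exact ⟨y, rfl, fun j => by split_ifs <;> simp⟩
  · refine ⟨axisReflection τ y, hF τ y, fun j => ?_⟩
    rw [axisReflection_apply]
    split_ifs <;> simp

/-- **A function on `ℝ³` invariant under the coordinate permutations and the coordinate reflections is
invariant under every isometry permuting the signed coordinate axes** (the hyperoctahedral group `B₃` is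
generated by `S₃` and the three reflections). [folklore] -/
theorem kernel_hyper_clc {T : EuclideanSpace ℝ (Fin 3) → ℝ}
    (hP : ∀ (π : Equiv.Perm (Fin 3)) (y : EuclideanSpace ℝ (Fin 3)),
      T (LinearIsometryEquiv.piLpCongrLeft 2 ℝ ℝ π y) = T y)
    (hF : ∀ (τ : Fin 3) (y : EuclideanSpace ℝ (Fin 3)), T (axisReflection τ y) = T y)
    (R : EuclideanSpace ℝ (Fin 3) ≃ₗᵢ[ℝ] EuclideanSpace ℝ (Fin 3))
    (hR : ∀ i : Fin 3, ∃ j : Fin 3, R (EuclideanSpace.single i 1) = EuclideanSpace.single j 1 ∨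
      R (EuclideanSpace.single i 1) = -EuclideanSpace.single j 1)
    (x : EuclideanSpace ℝ (Fin 3)) : T (R x) = T x := by
  obtain ⟨π, ε, hε, hb⟩ := exists_perm_signs_of_isHyper_clc R hR
  obtain ⟨y₂, hT₂, hy₂⟩ := flip_step_clc hF 2 (ε 2) (hε 2) x
  obtain ⟨y₁, hT₁, hy₁⟩ := flip_step_clc hF 1 (ε 1) (hε 1) y₂
  obtain ⟨y₀, hT₀, hy₀⟩ := flip_step_clc hF 0 (ε 0) (hε 0) y₁
  have hy : ∀ j, y₀ j = ε j * x j := by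
    intro j
    fin_cases j <;> simp [hy₀, hy₁, hy₂]
  have hRx : R x = LinearIsometryEquiv.piLpCongrLeft 2 ℝ ℝ π y₀ := by
    ext k
    rw [isHyper_apply_clc hε hb, coordPerm_apply, hy]
  rw [hRx, hP, hT₀, hT₁, hT₂]

/-! ## §6 The envelope -/

/-- On `ℝ³`, `‖x‖₂ < 2‖x‖_∞` for `x ≠ 0` (`‖x‖₂² ≤ 3‖x‖_∞²`). [folklore] -/
theorem norm_lt_two_mul_supNorm_clc {x : EuclideanSpace ℝ (Fin 3)} (hx : x ≠ 0) :
    ‖x‖ < 2 * ‖WithLp.ofLp x‖ := by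
  have hM : 0 < ‖WithLp.ofLp x‖ := norm_pos_iff.2 (by simpa using hx)
  have hcoord : ∀ i, ‖x i‖ ≤ ‖WithLp.ofLp x‖ := fun i => norm_le_pi_norm (WithLp.ofLp x) i
  have hsq : ‖x‖ ^ 2 ≤ 3 * ‖WithLp.ofLp x‖ ^ 2 := by
    rw [EuclideanSpace.norm_sq_eq]
    calc ∑ i : Fin 3, ‖x i‖ ^ 2 ≤ ∑ _i : Fin 3, ‖WithLp.ofLp x‖ ^ 2 :=
          Finset.sum_le_sum fun i _ => pow_le_pow_left₀ (norm_nonneg _) (hcoord i) 2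
      _ = 3 * ‖WithLp.ofLp x‖ ^ 2 := by simp
  have hlt : ‖x‖ ^ 2 < (2 * ‖WithLp.ofLp x‖) ^ 2 := by nlinarith
  exact lt_of_pow_lt_pow_left₀ 2 (by positivity) hlt

/-- **The envelope**: a cluster point with axis profile `t^{-2Δ}` satisfies `S 2 (0, x) ≤ 6^{2Δ}‖x‖^{-2Δ}` off `0`
(inward Messager–Miracle-Solé comparison along the cluster sequence at the axis pair `(0, (‖x‖/6)e₀)`).
[cite: MessagerMiracleSoleJSP1977, Theorem (monotonicity)] -/
theorem kernel_envelope_clc {Δ : ℝ} {S : CorrFamily 3} (hS : IsClusterPoint S)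
    (haxis : ∀ t : ℝ, 0 < t →
      S 2 (![0, EuclideanSpace.single 0 t] : Fin 2 → EuclideanSpace ℝ (Fin 3)) = t ^ (-(2 * Δ)))
    {x : EuclideanSpace ℝ (Fin 3)} (hx : x ≠ 0) :
    S 2 (![0, x] : Fin 2 → EuclideanSpace ℝ (Fin 3)) ≤ (6:ℝ) ^ (2 * Δ) * ‖x‖ ^ (-(2 * Δ)) := by
  have hx0 : 0 < ‖x‖ := norm_pos_iff.2 hx
  obtain ⟨s, hs⟩ : ∃ s : ℝ, s = ‖x‖ / 6 := ⟨_, rfl⟩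
  have hs0 : 0 < s := by rw [hs]; positivity
  have hle : S 2 (![0, x] : Fin 2 → EuclideanSpace ℝ (Fin 3)) ≤
      S 2 (![0, EuclideanSpace.single 0 s] : Fin 2 → EuclideanSpace ℝ (Fin 3)) := by
    refine clusterPoint_two_le_of_mul_norm_lt (clusterPoint_two_conv hS) (cfg0_mem hs0.ne')
      (zero_pair_mem_nonCoincident hx) ?_
    rw [norm_axisPair_sub', abs_of_pos hs0]
    have h2 : ‖x‖ < 2 * ‖WithLp.ofLp x‖ := norm_lt_two_mul_supNorm_clc hx
    have e : ‖WithLp.ofLp ((![0, x] : Fin 2 → EuclideanSpace ℝ (Fin 3)) 0) -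
        WithLp.ofLp ((![0, x] : Fin 2 → EuclideanSpace ℝ (Fin 3)) 1)‖ = ‖WithLp.ofLp x‖ := by
      simp
    rw [e, hs]
    linarith
  calc S 2 (![0, x] : Fin 2 → EuclideanSpace ℝ (Fin 3))
      ≤ S 2 (![0, EuclideanSpace.single 0 s] : Fin 2 → EuclideanSpace ℝ (Fin 3)) := hle
    _ = s ^ (-(2 * Δ)) := haxis s hs0
    _ = (6:ℝ) ^ (2 * Δ) * ‖x‖ ^ (-(2 * Δ)) := by
        rw [hs, Real.div_rpow hx0.le (by norm_num : (0:ℝ) ≤ 6), Real.rpow_neg (by norm_num : (0:ℝ) ≤ 6),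
          div_inv_eq_mul]
        exact mul_comm _ _

/-! ## §7 The registered stub -/

/-- **Registered stub `stub_clusterKernelOfRV`** of line `cluster-light-cone` (item stmt-CriticalPhenomena-4659):
under item 5047 (`TwoPointRegularVariation`) there is ONE `Δ ∈ [1/2, 1]` such that every member `S` of the
cluster set of the self-normalised critical `ℤ³` correlators has a two-point kernel `x ↦ S 2 (0, x)` that is
translation invariant, positive off `0`, invariant under every isometry permuting the signed coordinate axes, has
the pinned axis profile `S 2 (0, r e₀) = r^{-2Δ}` and the envelope `S 2 (0, x) ≤ C‖x‖^{-2Δ}`. [folklore] -/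
theorem stub_clusterKernelOfRV : open Literature.Probability.LatticeModels in Summit.CriticalPhenomena.Ising3DConformalLimit.Theses.BallOrbitComparison.TwoPointRegularVariation → ∃ Δ : ℝ, 1/2 ≤ Δ ∧ Δ ≤ 1 ∧ ∀ S ∈ {S : CorrFamily 3 | (∀ n x, x ∉ NonCoincident 3 n → S n x = 0) ∧ ∃ u : ℕ → ℝ, (∀ k, u k ∈ Set.Ioc (0:ℝ) 1) ∧ Filter.Tendsto u Filter.atTop (nhds 0) ∧ ∀ n, TendstoLocallyUniformlyOn (fun k => rescaledCorrelator (criticalCorr 3) (fun δ : ℝ => (criticalTwoPoint 3 (Pi.single 0 ⌊δ⁻¹⌋)) ^ (-(1/2:ℝ))) n (u k)) (S n) Filter.atTop (NonCoincident 3 n)}, (∀ x y : EuclideanSpace ℝ (Fin 3), x ≠ y → S 2 ![x, y] = S 2 ![0, y - x]) ∧ (∀ x : EuclideanSpace ℝ (Fin 3), x ≠ 0 → 0 < S 2 ![0, x]) ∧ (∀ R : EuclideanSpace ℝ (Fin 3) ≃ₗᵢ[ℝ] EuclideanSpace ℝ (Fin 3), (∀ i : Fin 3, ∃ j : Fin 3,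 R (EuclideanSpace.single i 1) = EuclideanSpace.single j 1 ∨ R (EuclideanSpace.single i 1) = -EuclideanSpace.single j 1) → ∀ x : EuclideanSpace ℝ (Fin 3), S 2 ![0, R x] = S 2 ![0, x]) ∧ (∀ r : ℝ, 0 < r → S 2 ![0, r • EuclideanSpace.single (0 : Fin 3) (1:ℝ)] = r ^ (-(2 * Δ))) ∧ (∃ C : ℝ, ∀ x : EuclideanSpace ℝ (Fin 3), x ≠ 0 → S 2 ![0, x] ≤ C * ‖x‖ ^ (-(2 * Δ))) := by
  intro hRV
  obtain ⟨Δ, _hΔ, hT⟩ := rv_ratio_rhoPin_clc hRV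
  obtain ⟨hlo, hhi⟩ := rv_window_clc hT
  refine ⟨Δ, hlo, hhi, fun S hS => ?_⟩
  have hN : ∀ n x, x ∉ NonCoincident 3 n → S n x = 0 := hS.1
  have hcp : IsClusterPoint S := isClusterPoint_of_mem_clusterSet hS
  have haxis : ∀ t : ℝ, 0 < t →
      S 2 (![0, EuclideanSpace.single 0 t] : Fin 2 → EuclideanSpace ℝ (Fin 3)) = t ^ (-(2 * Δ)) :=
    fun t ht => clusterPoint_axis_profile_clc hT hcp ht
  refine ⟨?_, ?_, ?_, ?_, ?_⟩
  · -- translation invariance of the kernel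
    intro x y hxy
    obtain ⟨u, hu, hconv⟩ := hcp
    have h := seqLimit_translate hu (hconv 2) (-x) (HyperoctahedralRPTwoPoint.pair_mem_nonCoincident hxy)
    have e : (fun i => (![x, y] : Fin 2 → EuclideanSpace ℝ (Fin 3)) i + -x) =
        (![0, y - x] : Fin 2 → EuclideanSpace ℝ (Fin 3)) := by
      funext i
      fin_cases i <;> simp [sub_eq_add_neg]
    rw [e] at h
    exact h.symm
  · -- positivity off `0`
    intro x hx
    exact clusterPoint_nondeg_two (clusterPoint_two_conv hcp) _ (zero_pair_mem_nonCoincident hx)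
  · -- hyperoctahedral invariance
    intro R hR x
    exact kernel_hyper_clc (T := fun y => S 2 (![0, y] : Fin 2 → EuclideanSpace ℝ (Fin 3)))
      (fun π y => kernel_coordPerm_clc hcp hN π y) (fun τ y => kernel_axisReflection_clc hcp hN τ y) R hR x
  · -- the pinned axis profile
    intro r hr
    rw [smul_single_one_clc, haxis r hr]
  · -- the envelope
    exact ⟨(6:ℝ) ^ (2 * Δ), fun x hx => kernel_envelope_clc hcp haxis hx⟩

end Summit.CriticalPhenomena.Ising3DConformalLimit.Cruxes.ClusterSetTotallyDisconnected.ClusterLightCone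

end
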